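import Mathlib
import HarnessLib
import Summits.HubbardSuperconductivity.HubbardSuperconductivity.Theorems.KLProgrammeKLRegimeVolumeLimitRateDoor

/-!
# Route `KLProgramme` — VL child (stmt-HubbardSuperconductivity-19858 / its gen-5 re-base), Cauchy stub `stub_vl_twoVolumeRate`:
# rate algebra IV — FINITE SUMS of rated families (cell gate-hubbard-kl, seat hubbard-kl-k3c4-p1 g4)

The `Rate∃` form of `…VolumeLimitRateEx` («∃ D ρ, ρ → 0 ∧ the registered two-volume inequality beyond fixed thresholds») is closed under
finite sums over any index `Finset` (`klre_finset_sum`; the zero family `klre_zero`): the shape in which a supplier that controls the carrier as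
a finite sum of pieces — over scales `n ≤ nScales β + 1` (the per-scale increments of the two-leg kernel), over spins, or over finitely
many graphs — discharges the stub piece by piece.  (Infinite families: `twoVolumeRate_of_termwise`, `…CauchyTermwise`.)  Pure bookkeeping.
-/

noncomputable section

namespace Summit.HubbardSuperconductivity.HubbardSuperconductivity.Theorems.KLRegimeSplit

set_option linter.dupNamespace false -- summit = problem name (single-conjunct summit), D-0017

open Filter Topology Finset Literature.MathematicalPhysics.QuantumLattice Literature.Probability.LatticeModels
open Summit.HubbardSuperconductivity.HubbardSuperconductivity.Theorems.KLProgrammeLegKernels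

/-- The zero family is in `Rate∃` (any thresholds). [folklore] -/
theorem klre_zero {L₀ : ℕ} {Mth : ℕ → ℕ} :
    ∃ D : ℝ, ∃ ρ : ℕ → ℝ, Tendsto ρ atTop (𝓝 0) ∧
      ∀ (L : ℕ) [NeZero L], L₀ ≤ L → ∀ (M : ℕ) [NeZero M], Mth L ≤ M →
        ∀ (L' : ℕ) [NeZero L'], L ≤ L' → ∀ (M' : ℕ) [NeZero M'], Mth L' ≤ M' →
          ∀ (σ : Fin 2) (ω : MatsubaraIdx M) (ω' : MatsubaraIdx M'), matsubaraInt M ω = matsubaraInt M' ω' →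
            ∀ (k : TorusSite 2 L) (k' : TorusSite 2 L'),
              ‖(fun (L M : ℕ) (_ : NeZero L) (_ : NeZero M) (_ : FreqMomentum L M) (_ : Fin 2) => (0 : ℂ)) L M ‹_› ‹_› (ω, k) σ -
                  (fun (L M : ℕ) (_ : NeZero L) (_ : NeZero M) (_ : FreqMomentum L M) (_ : Fin 2) => (0 : ℂ)) L' M' ‹_› ‹_› (ω', k') σ‖ ≤
                ρ L + D * ∑ i, torusAbs (latticeMomentum L k i - latticeMomentum L' k' i) :=
  ⟨0, fun _ => 0, tendsto_const_nhds, fun L _ _ M _ _ L' _ _ M' _ _ σ ω ω' _ k k' => by simp⟩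

/-- **Finite sums preserve `Rate∃`.**  For families `S i`, `i ∈ s`, each rated beyond the common thresholds `(L₀, Mth)`, the pointwise sum
`Σ_{i ∈ s} S i` is rated beyond the same thresholds. [folklore] -/
theorem klre_finset_sum {ι : Type*} [DecidableEq ι] (s : Finset ι)
    {S : ι → ∀ (L M : ℕ) [NeZero L] [NeZero M], FreqMomentum L M → Fin 2 → ℂ} {L₀ : ℕ} {Mth : ℕ → ℕ}
    (hS : ∀ i ∈ s, ∃ D : ℝ, ∃ ρ : ℕ → ℝ, Tendsto ρ atTop (𝓝 0) ∧
      ∀ (L : ℕ) [NeZero L], L₀ ≤ L → ∀ (M : ℕ) [NeZero M], Mth L ≤ M →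
        ∀ (L' : ℕ) [NeZero L'], L ≤ L' → ∀ (M' : ℕ) [NeZero M'], Mth L' ≤ M' →
          ∀ (σ : Fin 2) (ω : MatsubaraIdx M) (ω' : MatsubaraIdx M'), matsubaraInt M ω = matsubaraInt M' ω' →
            ∀ (k : TorusSite 2 L) (k' : TorusSite 2 L'),
              ‖S i L M (ω, k) σ - S i L' M' (ω', k') σ‖ ≤ ρ L + D * ∑ j, torusAbs (latticeMomentum L k j - latticeMomentum L' k' j)) :
    ∃ D : ℝ, ∃ ρ : ℕ → ℝ, Tendsto ρ atTop (𝓝 0) ∧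
      ∀ (L : ℕ) [NeZero L], L₀ ≤ L → ∀ (M : ℕ) [NeZero M], Mth L ≤ M →
        ∀ (L' : ℕ) [NeZero L'], L ≤ L' → ∀ (M' : ℕ) [NeZero M'], Mth L' ≤ M' →
          ∀ (σ : Fin 2) (ω : MatsubaraIdx M) (ω' : MatsubaraIdx M'), matsubaraInt M ω = matsubaraInt M' ω' →
            ∀ (k : TorusSite 2 L) (k' : TorusSite 2 L'),
              ‖(∑ i ∈ s, S i L M (ω, k) σ) - ∑ i ∈ s, S i L' M' (ω', k') σ‖ ≤
                ρ L + D * ∑ j, torusAbs (latticeMomentum L k j - latticeMomentum L' k' j) := by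
  classical
  induction s using Finset.induction_on with
  | empty =>
    exact ⟨0, fun _ => 0, tendsto_const_nhds, fun L _ _ M _ _ L' _ _ M' _ _ σ ω ω' _ k k' => by simp⟩
  | insert a s ha ih =>
    obtain ⟨D₁, ρ₁, hρ₁, h₁⟩ := hS a (Finset.mem_insert_self a s)
    obtain ⟨D₂, ρ₂, hρ₂, h₂⟩ := ih fun i hi => hS i (Finset.mem_insert_of_mem hi)
    refine ⟨D₁ + D₂, fun L => ρ₁ L + ρ₂ L, by simpa using hρ₁.add hρ₂, ?_⟩
    intro L _ hL M _ hM L' _ hLL' M' _ hM' σ ω ω' hωω' k k'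
    rw [Finset.sum_insert ha, Finset.sum_insert ha]
    have e₁ := h₁ L hL M hM L' hLL' M' hM' σ ω ω' hωω' k k'
    have e₂ := h₂ L hL M hM L' hLL' M' hM' σ ω ω' hωω' k k'
    calc ‖S a L M (ω, k) σ + ∑ i ∈ s, S i L M (ω, k) σ - (S a L' M' (ω', k') σ + ∑ i ∈ s, S i L' M' (ω', k') σ)‖
        = ‖(S a L M (ω, k) σ - S a L' M' (ω', k') σ) + (∑ i ∈ s, S i L M (ω, k) σ - ∑ i ∈ s, S i L' M' (ω', k') σ)‖ := by
          congr 1; abel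
      _ ≤ ‖S a L M (ω, k) σ - S a L' M' (ω', k') σ‖ + ‖∑ i ∈ s, S i L M (ω, k) σ - ∑ i ∈ s, S i L' M' (ω', k') σ‖ :=
          norm_add_le _ _
      _ ≤ _ := by
          have := add_le_add e₁ e₂
          exact this.trans_eq (by ring)

end Summit.HubbardSuperconductivity.HubbardSuperconductivity.Theorems.KLRegimeSplit

end
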